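import Mathlib

/-!
# Hodge-locus census (cell `pub-hlocus`, engine B, abs-2 gen 49): no 3-adic cancellation in `a² + 3b²`

certified instances and evidence bearing on the general Hodge conjecture; no claim.

Helper file of `stmt-HodgeConjecture-16267` (computational census records; nothing here is
used by any route).  Census record: `data/abs/engineB/DERIVATIONS_engineB.md` §66.12.

The cross product `w = μ_𝔞 × γμ_𝔟γ̄` of two embedded CM roots anticommutes with `μ_𝔞` and
therefore lies, locally at 3, in a rank-2 `ℤ₃`-lattice with norm form `a² + 3b²`; and
`N(w) = DD' − x_γ²` (Lagrange identity, anchor `FrontLawB`).  The arithmetic fact used in §66.12 —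
kernel-checked here over `ℤ` — is that `a² + 3b²` has no 3-adic cancellation: whenever
`a² + 3b² = 3^k · m` with `3 ∤ m`, the unit part satisfies `m ≡ 1 (mod 3)`
(`unitPart_mod_three`), whence the census congruence `m ≡ 1 (mod 3)` for the cofactor in
`DD' − x² = 4·3^{ℓ+1}·m` (`cofactor_mod_three`; certified numerically on 5 604 288 triples,
`XGAMMA-{W4u,W7,X8}.txt`).
-/

set_option linter.dupNamespace false

namespace Summit.HodgeConjecture.HodgeConjecture.HodgeLocus.Census.NoCancelB

/-- A square prime to 3 is `≡ 1 (mod 3)`. -/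
theorem sq_emod_three_of_not_dvd (a : ℤ) (ha : ¬ (3 : ℤ) ∣ a) : a ^ 2 % 3 = 1 := by
  have h : a % 3 = 1 ∨ a % 3 = 2 := by omega
  have hsq : a ^ 2 = a * a := sq a
  rcases h with h | h
  · rw [hsq, Int.mul_emod, h]; norm_num
  · rw [hsq, Int.mul_emod, h]; norm_num

/-- No cancellation: if `a² + 3b² = 3^k · m` with `3 ∤ m` then `m ≡ 1 (mod 3)`. -/
theorem unitPart_mod_three :
    ∀ (k : ℕ) (a b m : ℤ), a ^ 2 + 3 * b ^ 2 = 3 ^ k * m → ¬ (3 : ℤ) ∣ m → m % 3 = 1 := by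
  intro k
  induction k with
  | zero =>
    intro a b m h hm
    rw [pow_zero, one_mul] at h
    have ha : ¬ (3 : ℤ) ∣ a := by
      intro ha
      apply hm
      rw [← h]
      exact dvd_add (Dvd.dvd.pow ha two_ne_zero) (dvd_mul_right 3 _)
    have h1 := sq_emod_three_of_not_dvd a ha
    rw [← h]
    omega
  | succ k ih =>
    intro a b m h hm
    have h3a : (3 : ℤ) ∣ a := by
      have hsq : (3 : ℤ) ∣ a ^ 2 := by
        have h1 : (3 : ℤ) ∣ 3 ^ (k + 1) * m :=
          dvd_mul_of_dvd_left (dvd_pow_self 3 (Nat.succ_ne_zero k)) m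
        rw [← h] at h1
        exact (dvd_add_left (dvd_mul_right 3 (b ^ 2))).mp h1
      exact Int.prime_three.dvd_of_dvd_pow hsq
    obtain ⟨a', rfl⟩ := h3a
    apply ih b a' m _ hm
    have h2 : 3 * (b ^ 2 + 3 * a' ^ 2) = 3 * (3 ^ k * m) := by linear_combination h
    exact mul_left_cancel₀ (by norm_num : (3 : ℤ) ≠ 0) h2

/-- The census congruence: in `DD' − x² = a² + 3b² = 4·3^{ℓ+1}·m` with `3 ∤ m`, `m ≡ 1 (mod 3)`. -/
theorem cofactor_mod_three (a b m : ℤ) (ℓ : ℕ) (h : a ^ 2 + 3 * b ^ 2 = 4 * 3 ^ (ℓ + 1) * m)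
    (hm : ¬ (3 : ℤ) ∣ m) : m % 3 = 1 := by
  have h4 : ¬ (3 : ℤ) ∣ 4 * m := by omega
  have := unitPart_mod_three (ℓ + 1) a b (4 * m) (by rw [h]; ring) h4
  omega

-- The one-step exchange `(3a')² + 3b² = 3(b² + 3a'²)` (roles of the coordinates swapped: the parity
-- alternation of the census θ-levels) is already landed as
-- `Summit.HodgeConjecture.HodgeConjecture.HodgeLocus.Census.Depth12At3.sqrt_neg_three_step`
-- (HodgeLocusCensusDepth12At3.lean); it is not restated here.

/-- Census instance (−435, −543), level 9, `m = 1`: `435·543 − 3² = 4·3^10 = (2·3^5)² + 3·0²`. -/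
example : (2 * 3 ^ 5 : ℤ) ^ 2 + 3 * 0 ^ 2 = 4 * 3 ^ (9 + 1) * 1 := by norm_num

end Summit.HodgeConjecture.HodgeConjecture.HodgeLocus.Census.NoCancelB
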